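import Mathlib
import HarnessLib
import Summits.HubbardSuperconductivity.HubbardSuperconductivity.Theorems.KLProgrammeKLRegimeEngineTwoLegStepV17F2ZeroCloserSpLeg

/-!
# Stub (M) `stub_twoLeg_scale0` of the engine-flow child `KLRegimeEngineV17F2` (stmt-HubbardSuperconductivity-20437) — CLOSED BY NAME
# (cell gate-hubbard-kl, seat p1b g9, (M) owner; registered skeleton v1 sha16 f8654925219fd273, stub TYPE sha12 e46d07bd78b6)

The REGISTERED stub text verbatim, proved by p1b's `stub_twoLeg_scale0_of_spLeg_Q7U9` (…TwoLegStepV17F2ZeroCloserQ7U9: (M) modulo the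
scale-`0` spatial nested leg `hsp`; the cutoff leg is k3c4-p2's `twoLeg_scale0_hcutF_of_klEng`) with `hsp := twoLeg_scale0_hsp_klEngQ7U9`
(…TwoLegStepV17F2ZeroCloserSpLeg: k3c5-p2's β′ two-volume door `abs_klLocalPart_flowFrame_zero_sub_le_of_gridData_maj` at the registered
thresholds, data of …TwoVolumeScaleZeroSpLegData / k3c4-p2's `hsec_scaleZero`/`hs_scaleZero`, `|Δsp| ≤ 1/L₁ ≤ (klEngQ7 P R).CL β 0/4/L₁`).
So the scale-`0` two-leg step `TwoLegStepV17F2 … 0` ((E3a-F) reading jets, (E3d/e) slopes, (E3f-F) two-volume rate at `n = 0`) holds at the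
bare frame `K₀ = 0` from the stub's binders (the scale-`0` engine bounds `hE` and stub 6-F's reading jets `hJ` included).  Proof only; no
definition; nothing here asserts superconductivity.  References: BGM 2006 §2–§3 [cite: BenfattoGiulianiMastropietro2006].
-/

noncomputable section

namespace Summit.HubbardSuperconductivity.HubbardSuperconductivity.Theorems.EngineV8

set_option linter.dupNamespace false -- summit = problem name (single-conjunct summit), D-0017

open Real Finset Filter Literature.MathematicalPhysics.QuantumLattice Literature.Probability.LatticeModels
open Literature.MathematicalPhysics.QuantumLattice.FermiRG
open Summit.HubbardSuperconductivity.HubbardSuperconductivity.Theorems.KLProgrammeLegKernels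
open Summit.HubbardSuperconductivity.HubbardSuperconductivity.Theorems.DispersionFlow
open Summit.HubbardSuperconductivity.HubbardSuperconductivity.Theorems.KLRegimeSplit

/-- **(M) `stub_twoLeg_scale0`** — the scale-`0` two-leg step `TwoLegStepV17F2 … 0` at `K_0 = 0` ((E3a-F) reading jets by `curveJetBar`-monotonicity from stub 6-F, (E3d/e) slopes,
(E3f-F) two-volume rate at `n = 0`) from the scale-`0` engine bounds.  REGISTERED TEXT (skeleton v1 f8654925219fd273), CLOSED: `stub_twoLeg_scale0_of_spLeg_Q7U9`
∘ `twoLeg_scale0_hsp_klEngQ7U9`. -/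
theorem stub_twoLeg_scale0 :
    ∀ (P : SplitConsts) (R : RenConsts) (c : ℝ), P.WF → R.WF2 → 0 < c → c ≤ klEngC₃6 P R →
      ∀ μ ∈ klWindowC, ∀ U : ℝ, 0 < U → U ≤ klEngU₀9 P R c → ∀ β : ℝ, klBetaMin ≤ β → β ≤ Real.exp (c / U ^ 2) →
        ∀ (L M : ℕ) [NeZero L] [NeZero M], klEngL₃ β U ≤ L → klEngM₃ β U L ≤ M →
          FrameOK R U (nScales β) μ (klFlowFrameU L M β U μ 0) →
            EngineBoundsAtV17F2 L M klEngGeo7 P (klEngQ7 P R) β U μ 0 →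
              TwoLegReadJetBound L M klC4aJetC (klC4aJetC' P R) β U μ (klFlowFrameU L M β U μ 0) 0 →
                TwoLegStepV17F2 L M klEngGeo7 P (klEngQ7 P R) R β U μ 0 := by
  intro P R c hP hR hc hc3 μ hμ U hU hUle β hβ hβc L M _ _ hL hM hfr hE hJ
  exact stub_twoLeg_scale0_of_spLeg_Q7U9 P R c hP hR hc hc3 μ hμ U hU hUle β hβ hβc L M hL hM hfr hE hJ
    (fun Mq L₁ L₂ M₂ _ _ _ hLL₁ hdvd hM₁ hMq₁ hM₂ hMq₂ h₁ h₂ θ =>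
      twoLeg_scale0_hsp_klEngQ7U9 P hR.1 c hμ hU hUle hβ hL Mq L₁ L₂ M₂ hLL₁ hdvd hM₁ hMq₁ hM₂ hMq₂ h₁ h₂ θ)

end Summit.HubbardSuperconductivity.HubbardSuperconductivity.Theorems.EngineV8

end
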